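import Mathlib.LinearAlgebra.Matrix.BilinearForm
import Mathlib.LinearAlgebra.BilinearForm.IsometryEquiv
import Mathlib.LinearAlgebra.Matrix.SchurComplement
import Literature.AlgebraicGeometry.Hyperkaehler.GeneralizedKummerMonodromy
import Literature.AlgebraicGeometry.Hyperkaehler.K3HilbertType
import HarnessLib

/-!
# Markman's reflection group `𝒲 = ⟨ρ_u : (u,u) = ±2⟩`: the generators are isometries, `χ(ρ_u) = −(u,u)/2`,
# `det ρ_u = (u,u)/2`, and every element of `𝒲` acts on the discriminant group `Λ^*/Λ` by `±1`
# (Markman, JEMS 25 (2023) §1.1, (1.3)–(1.4); O'Grady, Cor. 1.4)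

Layer `Literature/AlgebraicGeometry/Hyperkaehler`. Written for lane `lit-hodgefound` (Track 2 foundations; prover seat
`lit-hodgefound-p18`, gen 43, row g43-#3). THEOREMS ONLY — no definition, no named fact, no instance, no notation.

The vocabulary is that of `GeneralizedKummerMonodromy.lean` §2 (used verbatim by `K3HilbertTypeMonodromy.lean` for
`Λ_n = k3HilbertGram n`): for an integral Gram matrix `G` on `ℤ^ι`, `gramPairing G` (the pairing), `gramReflections G`
(Markman's generators `ρ_u : w ↦ −ε w + (w,u) u`, `(u,u) = 2ε`, `ε = ±1`), `reflectionGroup G = 𝒲` (the subgroup of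
`Aut ℤ^ι` they generate), `ratExtend g` (`g ⊗ ℚ` through the integral matrix of `g`), `IsInDualLattice G f` (`f ∈ Λ^*`),
`ActsOnDiscriminantBy G g ε` (`(g ⊗ ℚ) f − ε f ∈ Λ` for all `f ∈ Λ^*`) and `detChiKer G = 𝒲^{det·χ}`. That file proves only
the trivial instances (`actsOnDiscriminantBy_one_one`, `one_mem_detChiKer`); this file proves the statements quoted below.

## Source, verbatim (E. Markman, *The monodromy of generalized Kummer varieties and algebraic cycles on their
intermediate Jacobians*, J. Eur. Math. Soc. 25 (2023), §1.1, held text `paper:arxiv-1805.11574` pp. 3–4)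

"Given an element `u` of `H²(Y,ℤ)` with `(u,u) = ±2`, let `ρ_u` be the isometry of `H²(Y,ℤ)` given by
`ρ_u(w) = −((u,u)/2)(w) + (u,w)u`" [display (1.3) defines `𝒲 := ⟨r_u : u ∈ H²(Y,ℤ) and (u,u) = ±2⟩` "to be the
subgroup of `O(H²(Y,ℤ))` generated by the elements `r_u`"]. "The residual group `H²(Y,ℤ)^*/H²(Y,ℤ)` is cyclic of order
`2dim_Y + 2`. The image of `𝒲` in the automorphism group of `H²(Y,ℤ)^*/H²(Y,ℤ)` has order `2` and is generated by
multiplication by `−1`, by [markman-monodromy-I]. We get a character `χ : 𝒲 → {1,−1} ⊂ ℂ^×`. […] Note that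
`det(r_u) = (u,u)/2` and `χ(r_u) = −(u,u)/2`. Consequently, their product `det·χ` takes `r_u` to `−1`, for both `+2` and
`−2` vectors `u`. Let `𝒲^{det·χ}` be the kernel of `det·χ`." K. O'Grady, *Compact tori associated to hyperkähler manifolds
of Kummer type*, IMRN (2021), Cor. 1.4: a monodromy operator "acts trivially on the discriminant group … or it acts as
multiplication by `−1`".

## Reading notes

* The discriminant action is formalised exactly as in `ActsOnDiscriminantBy`: "`g` acts on `Λ^*/Λ` as multiplication by
  `ε`" means `(g ⊗ ℚ) f − ε f ∈ Λ` for every `f ∈ Λ^* ⊂ ℚ^ι`. The statements here hold for EVERY integral Gram matrix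
  `G` (symmetric where isometry is concerned); no nondegeneracy is needed for the inclusion `image(𝒲) ⊆ {±1}`, which is
  what we prove ("has order `2`", i.e. `−1 ≠ 1` on `Λ^*/Λ` together with the existence of a `(+2)`-vector, is not restated).
* "`det(r_u) = (u,u)/2`": `ρ_u = −ε·s_u` with `s_u` the reflection in `u` (`det s_u = −1`), so `det ρ_u = −(−ε)^{rk}`;
  this equals `ε = (u,u)/2` exactly when the rank is ODD — as it is for Markman's lattices (`rk H²(Kumⁿ) = 7`,
  `rk Λ_{K3^{[n]}} = 23`). We prove `det ρ_u = −(−ε)^{rk}` in general and `= ε` for odd rank.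

## Contents (all proved)

* §1 `gramPairing_eq_toBilin'` (the bridge `(u,v)_G = Matrix.toBilin' G u v`), `gramPairing_comm`, (bi)linearity and signs;
  `ratExtend_eq_mulVec`, `ratExtend_intCast` (`g ⊗ ℚ` extends `g`), `ratExtend_add/sub/smul`, `ratExtend_comp`, `ratExtend_id'`,
  `ratExtend_symm_apply`, `gramPairingRat_intCast_right` (`(f, u)_ℚ` for integral `u`).
* §2 generators: **`gramPairing_apply_apply_of_gramReflection`** (`ρ_u` is an isometry, `G` symmetric) and its packaging
  `exists_isometryEquiv_coe_eq_of_gramReflection` as an `IsometryEquiv` of `Matrix.toBilin' G`; `toMatrix'_gramReflection`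
  (`[ρ_u] = −ε·1 + u·(Gu)ᵀ`), `ratExtend_gramReflection` (`(ρ_u ⊗ ℚ) f = −ε f + (f,u) u`),
  **`actsOnDiscriminantBy_neg_of_gramReflection`** (`χ(ρ_u) = −ε = −(u,u)/2`).
* §3 the group: `actsOnDiscriminantBy_mul`, `actsOnDiscriminantBy_inv`, `isometry_and_actsOnDiscriminantBy_of_mem_reflectionGroup`,
  **`gramPairing_apply_apply_of_mem_reflectionGroup`** (`𝒲 ⊂ O(Λ)`; `exists_isometryEquiv_coe_eq_of_mem_reflectionGroup`),
  **`actsOnDiscriminantBy_one_or_neg_one_of_mem_reflectionGroup`** (the image of `𝒲` in `Aut(Λ^*/Λ)` lies in `{±1}`).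
* §4 determinants: **`det_gramReflection`** (`det ρ_u = −(−ε)^{rk}`), **`det_gramReflection_of_odd`** (`det ρ_u = ε = (u,u)/2` in
  odd rank), `mul_mem_detChiKer_of_gramReflections` (`ρ_u ρ_v ∈ 𝒲^{det·χ}` in odd rank).
* §5 the two lattices of record, `k3HilbertGram n` (rank `23`) and `kumGram n` (rank `7`), have odd rank and symmetric Gram
  matrices, so all of the above applies: `det_gramReflection_k3HilbertGram`, `det_gramReflection_kumGram`,
  `isometry_and_actsOnDiscriminantBy_of_mem_reflectionGroup_k3HilbertGram/…_kumGram`, `mul_mem_detChiKer_kumGram`.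

## References

* [Markman2023GeneralizedKummers] E. Markman, The monodromy of generalized Kummer varieties and algebraic cycles on their
  intermediate Jacobians, J. Eur. Math. Soc. 25 (2023) 231–321: §1.1, (1.3), (1.4), p. 234.
* [OGrady2021KummerTori] K. G. O'Grady, Compact tori associated to hyperkähler manifolds of Kummer type, Int. Math. Res.
  Not. IMRN (2021): Cor. 1.4.
* [Markman2011Survey] E. Markman, A survey of Torelli and monodromy results for holomorphic-symplectic varieties, in:
  Complex and Differential Geometry, Springer Proc. Math. 8 (2011): §9.1.1, Lemma 9.2.
* [Serre1973] J.-P. Serre, A Course in Arithmetic, GTM 7, Springer 1973: Ch. IV §1.1 (bilinear forms of symmetric matrices).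
-/

noncomputable section

open Module Function Matrix

namespace Literature.AlgebraicGeometry.Hyperkaehler

variable {ι : Type} [Fintype ι] [DecidableEq ι]

/-! ### §1 The pairing `( , )_G = Matrix.toBilin' G` and the rational extension `g ⊗ ℚ` -/

/-- **The bridge**: the pairing `gramPairing G` of `GeneralizedKummerMonodromy` is Mathlib's `Matrix.toBilin' G` (the form of
the lattice files `Literature/Topology/FourManifolds/LatticeForms*.lean`). [cite: Markman2023GeneralizedKummers, §1.1 p. 234 (the lattice `(H²(Y,ℤ), ( , ))`)] -/
theorem gramPairing_eq_toBilin' (G : Matrix ι ι ℤ) (u v : ι → ℤ) : gramPairing G u v = Matrix.toBilin' G u v :=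
  (Matrix.toBilin'_apply G u v).symm

omit [DecidableEq ι] in
/-- `( , )_G` is symmetric for a symmetric Gram matrix. [cite: Markman2023GeneralizedKummers, §1.1 p. 234] -/
theorem gramPairing_comm {G : Matrix ι ι ℤ} (hG : G.transpose = G) (u v : ι → ℤ) : gramPairing G u v = gramPairing G v u := by
  classical
  rw [gramPairing_eq_toBilin', gramPairing_eq_toBilin']
  exact (Matrix.isSymm_toBilin'_iff_isSymm.2 hG).eq u v

omit [DecidableEq ι] in
/-- `( , )_G` is additive in the first variable. [cite: Serre1973, Ch. IV §1.1 (the bilinear form `(x, y) ↦ xᵀGy` of a symmetric matrix)] -/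
theorem gramPairing_add_left (G : Matrix ι ι ℤ) (u u' v : ι → ℤ) :
    gramPairing G (u + u') v = gramPairing G u v + gramPairing G u' v := by
  classical
  simp only [gramPairing_eq_toBilin', map_add, LinearMap.add_apply]

omit [DecidableEq ι] in
/-- `( , )_G` is homogeneous in the first variable. [cite: Serre1973, Ch. IV §1.1 (the bilinear form `(x, y) ↦ xᵀGy` of a symmetric matrix)] -/
theorem gramPairing_smul_left (G : Matrix ι ι ℤ) (a : ℤ) (u v : ι → ℤ) :
    gramPairing G (a • u) v = a * gramPairing G u v := by
  classical
  simp only [gramPairing_eq_toBilin', map_zsmul, LinearMap.smul_apply, smul_eq_mul]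

omit [DecidableEq ι] in
/-- `( , )_G` changes sign with the first variable. [cite: Serre1973, Ch. IV §1.1 (the bilinear form `(x, y) ↦ xᵀGy` of a symmetric matrix)] -/
theorem gramPairing_neg_left (G : Matrix ι ι ℤ) (u v : ι → ℤ) : gramPairing G (-u) v = -gramPairing G u v := by
  classical
  simp only [gramPairing_eq_toBilin', map_neg, LinearMap.neg_apply]

omit [DecidableEq ι] in
/-- `( , )_G` is additive in the second variable. [cite: Serre1973, Ch. IV §1.1 (the bilinear form `(x, y) ↦ xᵀGy` of a symmetric matrix)] -/
theorem gramPairing_add_right (G : Matrix ι ι ℤ) (u v v' : ι → ℤ) :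
    gramPairing G u (v + v') = gramPairing G u v + gramPairing G u v' := by
  classical
  simp only [gramPairing_eq_toBilin', map_add]

omit [DecidableEq ι] in
/-- `( , )_G` is homogeneous in the second variable. [cite: Serre1973, Ch. IV §1.1 (the bilinear form `(x, y) ↦ xᵀGy` of a symmetric matrix)] -/
theorem gramPairing_smul_right (G : Matrix ι ι ℤ) (a : ℤ) (u v : ι → ℤ) :
    gramPairing G u (a • v) = a * gramPairing G u v := by
  classical
  simp only [gramPairing_eq_toBilin', map_zsmul, smul_eq_mul]

omit [DecidableEq ι] in
/-- `( , )_G` changes sign with the second variable. [cite: Serre1973, Ch. IV §1.1 (the bilinear form `(x, y) ↦ xᵀGy` of a symmetric matrix)] -/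
theorem gramPairing_neg_right (G : Matrix ι ι ℤ) (u v : ι → ℤ) : gramPairing G u (-v) = -gramPairing G u v := by
  classical
  simp only [gramPairing_eq_toBilin', map_neg]

omit [DecidableEq ι] in
/-- The rational pairing on an integral second argument: `(f, u)_ℚ = Σ_j f_j · (Gu)_j` (plumbing). [folklore] -/
private theorem gramPairingRat_intCast_right (G : Matrix ι ι ℤ) (f : ι → ℚ) (u : ι → ℤ) :
    gramPairingRat G f (fun k ↦ (u k : ℚ)) = ∑ j, f j * ((G *ᵥ u) j : ℤ) := by
  simp only [gramPairingRat, Matrix.mulVec, dotProduct, Int.cast_sum, Int.cast_mul, Finset.mul_sum, mul_assoc]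

/-- `g ⊗ ℚ` is multiplication by the integral matrix of `g` (plumbing). [folklore] -/
private theorem ratExtend_eq_mulVec (g : (ι → ℤ) →ₗ[ℤ] (ι → ℤ)) (x : ι → ℚ) :
    ratExtend g x = (LinearMap.toMatrix' g).map (Int.castRingHom ℚ) *ᵥ x := rfl

/-- **`g ⊗ ℚ` extends `g`**: on integral vectors `ratExtend g` is `g` (the lattice inside `Λ ⊗ ℚ` is preserved). [cite: Markman2023GeneralizedKummers, §1.1 p. 234 (`O(H²(Y,ℤ))` acting on `H²(Y,ℚ) ⊃ H²(Y,ℤ)^* ⊃ H²(Y,ℤ)`, the residual group `H²(Y,ℤ)^*/H²(Y,ℤ)`)] -/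
theorem ratExtend_intCast (g : (ι → ℤ) →ₗ[ℤ] (ι → ℤ)) (v : ι → ℤ) :
    ratExtend g (fun i ↦ (v i : ℚ)) = fun i ↦ ((g v) i : ℚ) := by
  funext i
  rw [ratExtend_eq_mulVec]
  have h := RingHom.map_mulVec (Int.castRingHom ℚ) (LinearMap.toMatrix' g) v i
  rw [LinearMap.toMatrix'_mulVec] at h
  exact h.symm

/-- `g ⊗ ℚ` is additive (`𝒲` acts linearly on `Λ ⊗ ℚ`). [cite: Markman2023GeneralizedKummers, §1.1 p. 234 (`O(H²(Y,ℤ))` acting on `H²(Y,ℚ) ⊃ H²(Y,ℤ)^* ⊃ H²(Y,ℤ)`, the residual group `H²(Y,ℤ)^*/H²(Y,ℤ)`)] -/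
theorem ratExtend_add (g : (ι → ℤ) →ₗ[ℤ] (ι → ℤ)) (x y : ι → ℚ) : ratExtend g (x + y) = ratExtend g x + ratExtend g y := by
  rw [ratExtend_eq_mulVec, ratExtend_eq_mulVec, ratExtend_eq_mulVec, Matrix.mulVec_add]

/-- `g ⊗ ℚ` is compatible with subtraction. [cite: Markman2023GeneralizedKummers, §1.1 p. 234 (`O(H²(Y,ℤ))` acting on `H²(Y,ℚ) ⊃ H²(Y,ℤ)^* ⊃ H²(Y,ℤ)`, the residual group `H²(Y,ℤ)^*/H²(Y,ℤ)`)] -/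
theorem ratExtend_sub (g : (ι → ℤ) →ₗ[ℤ] (ι → ℤ)) (x y : ι → ℚ) : ratExtend g (x - y) = ratExtend g x - ratExtend g y := by
  rw [ratExtend_eq_mulVec, ratExtend_eq_mulVec, ratExtend_eq_mulVec, Matrix.mulVec_sub]

/-- `g ⊗ ℚ` is `ℚ`-linear. [cite: Markman2023GeneralizedKummers, §1.1 p. 234 (`O(H²(Y,ℤ))` acting on `H²(Y,ℚ) ⊃ H²(Y,ℤ)^* ⊃ H²(Y,ℤ)`, the residual group `H²(Y,ℤ)^*/H²(Y,ℤ)`)] -/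
theorem ratExtend_smul (g : (ι → ℤ) →ₗ[ℤ] (ι → ℤ)) (c : ℚ) (x : ι → ℚ) : ratExtend g (c • x) = c • ratExtend g x := by
  rw [ratExtend_eq_mulVec, ratExtend_eq_mulVec, Matrix.mulVec_smul]

/-- `(g ∘ h) ⊗ ℚ = (g ⊗ ℚ) ∘ (h ⊗ ℚ)` (the action of `O(Λ)` on `Λ ⊗ ℚ` is an action). [cite: Markman2023GeneralizedKummers, §1.1 p. 234 (`O(H²(Y,ℤ))` acting on `H²(Y,ℚ) ⊃ H²(Y,ℤ)^* ⊃ H²(Y,ℤ)`, the residual group `H²(Y,ℤ)^*/H²(Y,ℤ)`)] -/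
theorem ratExtend_comp (g h : (ι → ℤ) →ₗ[ℤ] (ι → ℤ)) (x : ι → ℚ) : ratExtend (g ∘ₗ h) x = ratExtend g (ratExtend h x) := by
  rw [ratExtend_eq_mulVec, ratExtend_eq_mulVec, ratExtend_eq_mulVec, LinearMap.toMatrix'_comp, Matrix.map_mul,
    Matrix.mulVec_mulVec]

/-- `id ⊗ ℚ = id`. [cite: Markman2023GeneralizedKummers, §1.1 p. 234 (`O(H²(Y,ℤ))` acting on `H²(Y,ℚ) ⊃ H²(Y,ℤ)^* ⊃ H²(Y,ℤ)`, the residual group `H²(Y,ℤ)^*/H²(Y,ℤ)`)] -/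
theorem ratExtend_id' (x : ι → ℚ) : ratExtend (LinearMap.id : (ι → ℤ) →ₗ[ℤ] (ι → ℤ)) x = x := by
  rw [ratExtend_eq_mulVec, LinearMap.toMatrix'_id, Matrix.map_one _ (map_zero _) (map_one _), Matrix.one_mulVec]

/-- `g⁻¹ ⊗ ℚ` inverts `g ⊗ ℚ`. [cite: Markman2023GeneralizedKummers, §1.1 p. 234 (`O(H²(Y,ℤ))` acting on `H²(Y,ℚ) ⊃ H²(Y,ℤ)^* ⊃ H²(Y,ℤ)`, the residual group `H²(Y,ℤ)^*/H²(Y,ℤ)`)] -/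
theorem ratExtend_symm_apply (g : (ι → ℤ) ≃ₗ[ℤ] (ι → ℤ)) (x : ι → ℚ) :
    ratExtend g.symm.toLinearMap (ratExtend g.toLinearMap x) = x := by
  rw [← ratExtend_comp, LinearEquiv.symm_comp, ratExtend_id']

/-! ### §2 The generators `ρ_u`: isometries with `χ(ρ_u) = −(u,u)/2` -/

section Generator

variable {G : Matrix ι ι ℤ} {g : (ι → ℤ) ≃ₗ[ℤ] (ι → ℤ)} {u : ι → ℤ} {ε : ℤ}

omit [DecidableEq ι] in
/-- **`ρ_u` is an isometry** ("let `ρ_u` be the isometry of `H²(Y,ℤ)` given by `ρ_u(w) = −((u,u)/2)w + (u,w)u`"): for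
`G` symmetric, `(u,u) = 2ε`, `ε = ±1`, the map `w ↦ −εw + (w,u)u` preserves `( , )_G`.
[cite: Markman2023GeneralizedKummers, §1.1 (1.3), p. 234] -/
theorem gramPairing_apply_apply_of_gramReflection (hG : G.transpose = G) (hε : ε = 1 ∨ ε = -1)
    (hu : gramPairing G u u = 2 * ε) (hg : ∀ w, g w = -ε • w + gramPairing G w u • u) (w w' : ι → ℤ) :
    gramPairing G (g w) (g w') = gramPairing G w w' := by
  have hε2 : ε * ε = 1 := by rcases hε with rfl | rfl <;> norm_num
  rw [hg w, hg w']
  simp only [gramPairing_add_left, gramPairing_add_right, gramPairing_smul_left, gramPairing_smul_right, hu,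
    gramPairing_comm hG u w']
  linear_combination (gramPairing G w w') * hε2

/-- A generator `ρ_u` of `𝒲`, packaged as an isometry of the bilinear form `Matrix.toBilin' G` of the lattice files.
[cite: Markman2023GeneralizedKummers, §1.1 (1.3), p. 234] -/
theorem exists_isometryEquiv_coe_eq_of_gramReflection (hG : G.transpose = G) (hε : ε = 1 ∨ ε = -1)
    (hu : gramPairing G u u = 2 * ε) (hg : ∀ w, g w = -ε • w + gramPairing G w u • u) :
    ∃ e : (Matrix.toBilin' G).IsometryEquiv (Matrix.toBilin' G), ∀ w, e w = g w := by
  refine ⟨{ g with map_app' := fun w w' ↦ ?_ }, fun _ ↦ rfl⟩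
  change Matrix.toBilin' G (g w) (g w') = Matrix.toBilin' G w w'
  rw [← gramPairing_eq_toBilin', ← gramPairing_eq_toBilin']
  exact gramPairing_apply_apply_of_gramReflection hG hε hu hg w w'

/-- **The matrix of `ρ_u`**: `[ρ_u] = −ε·1 + u·(Gu)ᵀ` (`[ρ_u]_{ij} = −εδ_{ij} + u_i (Gu)_j`). [cite: Markman2023GeneralizedKummers, §1.1 (1.3), p. 234] -/
theorem toMatrix'_gramReflection (hg : ∀ w, g w = -ε • w + gramPairing G w u • u) :
    LinearMap.toMatrix' g.toLinearMap = -ε • (1 : Matrix ι ι ℤ) + vecMulVec u (G *ᵥ u) := by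
  ext i j
  rw [LinearMap.toMatrix'_apply, LinearEquiv.coe_coe, hg]
  simp only [Pi.add_apply, Pi.smul_apply, smul_eq_mul, Matrix.add_apply, Matrix.smul_apply, Matrix.one_apply,
    vecMulVec_apply, Pi.single_apply, gramPairing, ite_mul, one_mul, zero_mul, Finset.sum_ite_irrel,
    Finset.sum_const_zero, Finset.sum_ite_eq', Finset.mem_univ, if_true, mulVec, dotProduct]
  split_ifs <;> ring

/-- **`(ρ_u ⊗ ℚ) f = −ε f + (f,u) u`** on `ℚ^ι` (the rational extension of the integral formula).
[cite: Markman2023GeneralizedKummers, §1.1 (1.3), p. 234] -/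
theorem ratExtend_gramReflection (hg : ∀ w, g w = -ε • w + gramPairing G w u • u) (f : ι → ℚ) :
    ratExtend g.toLinearMap f = -(ε : ℚ) • f + gramPairingRat G f (fun k ↦ (u k : ℚ)) • (fun i ↦ (u i : ℚ)) := by
  rw [ratExtend_eq_mulVec, toMatrix'_gramReflection hg]
  funext i
  simp only [mulVec, dotProduct, Matrix.map_apply, Matrix.add_apply, Matrix.smul_apply, Matrix.one_apply,
    vecMulVec_apply, smul_eq_mul, mul_ite, mul_one, mul_zero, eq_intCast, Int.cast_add, Int.cast_mul, Int.cast_neg,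
    Int.cast_ite, Int.cast_zero, Pi.add_apply, Pi.smul_apply, gramPairingRat, add_mul,
    Finset.sum_add_distrib, ite_mul, zero_mul, Finset.sum_ite_eq, Finset.mem_univ, if_true, Int.cast_sum,
    Finset.sum_mul, Finset.mul_sum]
  refine congrArg₂ (· + ·) (by ring) (Finset.sum_congr rfl fun j _ ↦ Finset.sum_congr rfl fun k _ ↦ by ring)

/-- **`χ(ρ_u) = −(u,u)/2`**: the generator `ρ_u` (`(u,u) = 2ε`) acts on the discriminant group `Λ^*/Λ` as multiplication
by `−ε`: for `f ∈ Λ^*`, `(ρ_u ⊗ ℚ) f − (−ε) f = (f,u)·u ∈ Λ` because `(f,u) ∈ ℤ`.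
[cite: Markman2023GeneralizedKummers, §1.1 p. 234 ("`χ(r_u) = −(u,u)/2`")] -/
theorem actsOnDiscriminantBy_neg_of_gramReflection (hg : ∀ w, g w = -ε • w + gramPairing G w u • u) :
    ActsOnDiscriminantBy G g (-ε) := by
  intro f hf
  obtain ⟨m, hm⟩ := hf u
  refine ⟨m • u, fun i ↦ ?_⟩
  rw [ratExtend_gramReflection hg, hm]
  simp only [Pi.add_apply, Pi.smul_apply, smul_eq_mul, Int.cast_neg, Int.cast_mul]
  ring

end Generator

/-! ### §3 The group `𝒲`: isometries acting on `Λ^*/Λ` by `±1` -/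

section Group

variable {G : Matrix ι ι ℤ}

/-- **`χ` is multiplicative**: if `g` acts on `Λ^*/Λ` by `ε₁` and `h` by `ε₂` then `gh` acts by `ε₁ε₂`
(`g(hf) − ε₁ε₂f = g(hf − ε₂f) + ε₂(gf − ε₁f)`). [cite: Markman2023GeneralizedKummers, §1.1 (1.4), p. 234 ("We get a character `χ : 𝒲 → {1,−1}`")] -/
theorem actsOnDiscriminantBy_mul {g h : (ι → ℤ) ≃ₗ[ℤ] (ι → ℤ)} {ε₁ ε₂ : ℤ} (hg : ActsOnDiscriminantBy G g ε₁)
    (hh : ActsOnDiscriminantBy G h ε₂) : ActsOnDiscriminantBy G (g * h) (ε₁ * ε₂) := by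
  intro f hf
  obtain ⟨v, hv⟩ := hh f hf
  obtain ⟨v', hv'⟩ := hg f hf
  have hv1 : ratExtend h.toLinearMap f - (ε₂ : ℚ) • f = fun i ↦ (v i : ℚ) := funext fun i ↦ by
    rw [Pi.sub_apply, Pi.smul_apply, smul_eq_mul]; exact hv i
  have hv1' : ratExtend g.toLinearMap f - (ε₁ : ℚ) • f = fun i ↦ (v' i : ℚ) := funext fun i ↦ by
    rw [Pi.sub_apply, Pi.smul_apply, smul_eq_mul]; exact hv' i
  refine ⟨g v + ε₂ • v', fun i ↦ ?_⟩
  have hmul : (g * h).toLinearMap = g.toLinearMap ∘ₗ h.toLinearMap := rfl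
  have key : ratExtend (g * h).toLinearMap f - ((ε₁ * ε₂ : ℤ) : ℚ) • f =
      ratExtend g.toLinearMap (ratExtend h.toLinearMap f - (ε₂ : ℚ) • f) +
        (ε₂ : ℚ) • (ratExtend g.toLinearMap f - (ε₁ : ℚ) • f) := by
    rw [hmul, ratExtend_comp, ratExtend_sub, ratExtend_smul, Int.cast_mul, smul_sub, smul_smul, mul_comm (ε₂ : ℚ)]
    abel
  have key' := congr_fun key i
  rw [hv1, hv1', ratExtend_intCast] at key'
  rw [Pi.sub_apply, Pi.smul_apply, smul_eq_mul] at key'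
  rw [key']
  simp only [Pi.add_apply, Pi.smul_apply, smul_eq_mul, Int.cast_add, Int.cast_mul]
  rfl

/-- **`χ(g⁻¹) = χ(g)`**: if `g` acts on `Λ^*/Λ` by `ε = ±1` then so does `g⁻¹` (`g⁻¹f − εf = −ε·g⁻¹(gf − εf)`).
[cite: Markman2023GeneralizedKummers, §1.1 (1.4), p. 234] -/
theorem actsOnDiscriminantBy_inv {g : (ι → ℤ) ≃ₗ[ℤ] (ι → ℤ)} {ε : ℤ} (hε : ε = 1 ∨ ε = -1)
    (hg : ActsOnDiscriminantBy G g ε) : ActsOnDiscriminantBy G g⁻¹ ε := by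
  intro f hf
  obtain ⟨v, hv⟩ := hg f hf
  have hv1 : ratExtend g.toLinearMap f - (ε : ℚ) • f = fun i ↦ (v i : ℚ) := funext fun i ↦ by
    rw [Pi.sub_apply, Pi.smul_apply, smul_eq_mul]; exact hv i
  have hε2 : (ε : ℚ) * ε = 1 := by rcases hε with rfl | rfl <;> norm_num
  have hinv : (g⁻¹ : (ι → ℤ) ≃ₗ[ℤ] (ι → ℤ)).toLinearMap = g.symm.toLinearMap := rfl
  have key : ratExtend g.symm.toLinearMap f - (ε : ℚ) • f =
      -(ε : ℚ) • ratExtend g.symm.toLinearMap (ratExtend g.toLinearMap f - (ε : ℚ) • f) := by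
    rw [ratExtend_sub, ratExtend_smul, ratExtend_symm_apply, smul_sub, smul_smul, neg_mul, hε2, neg_smul, neg_smul,
      one_smul, sub_neg_eq_add]
    abel
  refine ⟨-ε • g.symm v, fun i ↦ ?_⟩
  have key' := congr_fun key i
  rw [hv1, ratExtend_intCast, Pi.sub_apply, Pi.smul_apply, smul_eq_mul] at key'
  rw [hinv, key']
  simp only [Pi.smul_apply, smul_eq_mul, Int.cast_neg, Int.cast_mul, neg_mul]
  rfl

/-- **`𝒲 ⊂ O(Λ)` and the image of `𝒲` in `Aut(Λ^*/Λ)` lies in `{±1}`** ("`𝒲` … the subgroup of `O(H²(Y,ℤ))` generated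
by the elements `r_u`"; "The image of `𝒲` in the automorphism group of `H²(Y,ℤ)^*/H²(Y,ℤ)` has order `2` and is
generated by multiplication by `−1`"): for `G` symmetric, every `g ∈ 𝒲(G)` preserves `( , )_G` and acts on `Λ^*/Λ` by
`+1` or by `−1`. [cite: Markman2023GeneralizedKummers, §1.1 (1.3)–(1.4), p. 234] [cite: OGrady2021KummerTori, Cor. 1.4] -/
theorem isometry_and_actsOnDiscriminantBy_of_mem_reflectionGroup (hG : G.transpose = G) {g : (ι → ℤ) ≃ₗ[ℤ] (ι → ℤ)}
    (hg : g ∈ reflectionGroup G) :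
    (∀ w w', gramPairing G (g w) (g w') = gramPairing G w w') ∧
      (ActsOnDiscriminantBy G g 1 ∨ ActsOnDiscriminantBy G g (-1)) := by
  refine Subgroup.closure_induction (p := fun g _ ↦ (∀ w w', gramPairing G (g w) (g w') = gramPairing G w w') ∧
      (ActsOnDiscriminantBy G g 1 ∨ ActsOnDiscriminantBy G g (-1))) ?_ ?_ ?_ ?_ hg
  · rintro g ⟨u, ε, hε, hu, hgw⟩
    refine ⟨gramPairing_apply_apply_of_gramReflection hG hε hu hgw, ?_⟩
    rcases hε with rfl | rfl
    · exact Or.inr (actsOnDiscriminantBy_neg_of_gramReflection hgw)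
    · exact Or.inl (by simpa using actsOnDiscriminantBy_neg_of_gramReflection hgw)
  · exact ⟨fun _ _ ↦ rfl, Or.inl (actsOnDiscriminantBy_one_one G)⟩
  · rintro g h - - ⟨hg1, hg2⟩ ⟨hh1, hh2⟩
    refine ⟨fun w w' ↦ by rw [LinearEquiv.mul_eq_trans, LinearEquiv.trans_apply, LinearEquiv.trans_apply, hg1, hh1], ?_⟩
    rcases hg2 with hg2 | hg2 <;> rcases hh2 with hh2 | hh2
    · exact Or.inl (by simpa using actsOnDiscriminantBy_mul hg2 hh2)
    · exact Or.inr (by simpa using actsOnDiscriminantBy_mul hg2 hh2)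
    · exact Or.inr (by simpa using actsOnDiscriminantBy_mul hg2 hh2)
    · exact Or.inl (by simpa using actsOnDiscriminantBy_mul hg2 hh2)
  · rintro g - ⟨hg1, hg2⟩
    refine ⟨fun w w' ↦ ?_, ?_⟩
    · have h1 := hg1 (g⁻¹ w) (g⁻¹ w')
      have h2 : ∀ x, g (g⁻¹ x) = x := fun x ↦ g.apply_symm_apply x
      rw [h2, h2] at h1
      exact h1.symm
    · rcases hg2 with hg2 | hg2
      · exact Or.inl (actsOnDiscriminantBy_inv (Or.inl rfl) hg2)
      · exact Or.inr (actsOnDiscriminantBy_inv (Or.inr rfl) hg2)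

/-- **`𝒲 ⊂ O(Λ)`**: every element of Markman's reflection group preserves the pairing (`G` symmetric).
[cite: Markman2023GeneralizedKummers, §1.1 (1.3), p. 234] -/
theorem gramPairing_apply_apply_of_mem_reflectionGroup (hG : G.transpose = G) {g : (ι → ℤ) ≃ₗ[ℤ] (ι → ℤ)}
    (hg : g ∈ reflectionGroup G) (w w' : ι → ℤ) : gramPairing G (g w) (g w') = gramPairing G w w' :=
  (isometry_and_actsOnDiscriminantBy_of_mem_reflectionGroup hG hg).1 w w'

/-- An element of `𝒲(G)`, packaged as an isometry of `Matrix.toBilin' G` (the `O(Λ)` of the lattice files).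
[cite: Markman2023GeneralizedKummers, §1.1 (1.3), p. 234] -/
theorem exists_isometryEquiv_coe_eq_of_mem_reflectionGroup (hG : G.transpose = G) {g : (ι → ℤ) ≃ₗ[ℤ] (ι → ℤ)}
    (hg : g ∈ reflectionGroup G) : ∃ e : (Matrix.toBilin' G).IsometryEquiv (Matrix.toBilin' G), ∀ w, e w = g w := by
  refine ⟨{ g with map_app' := fun w w' ↦ ?_ }, fun _ ↦ rfl⟩
  change Matrix.toBilin' G (g w) (g w') = Matrix.toBilin' G w w'
  rw [← gramPairing_eq_toBilin', ← gramPairing_eq_toBilin']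
  exact gramPairing_apply_apply_of_mem_reflectionGroup hG hg w w'

/-- **The image of `𝒲` in `Aut(Λ^*/Λ)` lies in `{±1}`**: every `g ∈ 𝒲(G)` acts on the discriminant group as `+1` or as
`−1` (so `χ : 𝒲 → {±1}` is defined). [cite: Markman2023GeneralizedKummers, §1.1 (1.4), p. 234] [cite: OGrady2021KummerTori, Cor. 1.4] -/
theorem actsOnDiscriminantBy_one_or_neg_one_of_mem_reflectionGroup (hG : G.transpose = G)
    {g : (ι → ℤ) ≃ₗ[ℤ] (ι → ℤ)} (hg : g ∈ reflectionGroup G) :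
    ActsOnDiscriminantBy G g 1 ∨ ActsOnDiscriminantBy G g (-1) :=
  (isometry_and_actsOnDiscriminantBy_of_mem_reflectionGroup hG hg).2

end Group

/-! ### §4 `det ρ_u = (u,u)/2` (odd rank) and `ρ_u ρ_v ∈ 𝒲^{det·χ}` -/

section Det

variable {G : Matrix ι ι ℤ} {g : (ι → ℤ) ≃ₗ[ℤ] (ι → ℤ)} {u : ι → ℤ} {ε : ℤ}

/-- **`det ρ_u = −(−ε)^{rk}`** for `ρ_u = w ↦ −εw + (w,u)u`, `(u,u) = 2ε`: `[ρ_u] = −ε(1 + (−εu)(Gu)ᵀ)` and the matrix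
determinant lemma `det(1 + abᵀ) = 1 + bᵀa = 1 − ε(u,u) = −1`. [cite: Markman2023GeneralizedKummers, §1.1 p. 234 ("`det(r_u) = (u,u)/2`")] -/
theorem det_gramReflection (hε : ε = 1 ∨ ε = -1) (hu : gramPairing G u u = 2 * ε)
    (hg : ∀ w, g w = -ε • w + gramPairing G w u • u) : LinearMap.det g.toLinearMap = -(-ε) ^ Fintype.card ι := by
  have hε2 : ε * ε = 1 := by rcases hε with rfl | rfl <;> norm_num
  rw [← LinearMap.det_toMatrix', toMatrix'_gramReflection hg]
  have h1 : -ε • (1 : Matrix ι ι ℤ) + vecMulVec u (G *ᵥ u) = -ε • (1 + vecMulVec ((-ε) • u) (G *ᵥ u)) := by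
    ext i j
    simp only [Matrix.add_apply, Matrix.smul_apply, vecMulVec_apply, Pi.smul_apply, smul_eq_mul]
    linear_combination (-(u i * (G *ᵥ u) j)) * hε2
  have h2 : (G *ᵥ u) ⬝ᵥ u = 2 * ε := by
    rw [← hu, gramPairing_eq_toBilin', Matrix.toBilin'_apply', dotProduct_comm]
  rw [h1, Matrix.det_smul, vecMulVec_eq Unit, det_one_add_replicateCol_mul_replicateRow, dotProduct_smul, h2,
    smul_eq_mul]
  linear_combination (-2 * (-ε) ^ Fintype.card ι) * hε2

/-- **`det ρ_u = (u,u)/2 = ε` in ODD rank** (Markman's lattices: `rk H²(Kumⁿ,ℤ) = 7`, `rk Λ_{K3^{[n]}} = 23`).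
[cite: Markman2023GeneralizedKummers, §1.1 p. 234 ("Note that `det(r_u) = (u,u)/2`")] -/
theorem det_gramReflection_of_odd (hι : Odd (Fintype.card ι)) (hε : ε = 1 ∨ ε = -1)
    (hu : gramPairing G u u = 2 * ε) (hg : ∀ w, g w = -ε • w + gramPairing G w u • u) :
    LinearMap.det g.toLinearMap = ε := by
  rw [det_gramReflection hε hu hg, hι.neg_pow, neg_neg]
  rcases hε with rfl | rfl
  · exact one_pow _
  · exact hι.neg_one_pow

/-- **`det·χ` takes `r_u` to `−1` … Let `𝒲^{det·χ}` be the kernel of `det·χ`**: in odd rank a product of TWO generators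
`ρ_u ρ_v` lies in `𝒲^{det·χ} = detChiKer G` (`det = ε₁ε₂ = χ`). [cite: Markman2023GeneralizedKummers, §1.1 p. 234] -/
theorem mul_mem_detChiKer_of_gramReflections (hι : Odd (Fintype.card ι)) {g h : (ι → ℤ) ≃ₗ[ℤ] (ι → ℤ)}
    (hg : g ∈ gramReflections G) (hh : h ∈ gramReflections G) : g * h ∈ detChiKer G := by
  obtain ⟨u, ε₁, hε₁, hu, hgw⟩ := hg
  obtain ⟨v, ε₂, hε₂, hv, hhw⟩ := hh
  refine ⟨(reflectionGroup G).mul_mem (mem_reflectionGroup_of_mem_gramReflections ⟨u, ε₁, hε₁, hu, hgw⟩)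
    (mem_reflectionGroup_of_mem_gramReflections ⟨v, ε₂, hε₂, hv, hhw⟩), ?_⟩
  have hdet : LinearMap.det (g * h).toLinearMap = ε₁ * ε₂ := by
    change LinearMap.det (g.toLinearMap ∘ₗ h.toLinearMap) = _
    rw [LinearMap.det_comp, det_gramReflection_of_odd hι hε₁ hu hgw, det_gramReflection_of_odd hι hε₂ hv hhw]
  have hact : ActsOnDiscriminantBy G (g * h) (ε₁ * ε₂) := by
    have h1 := actsOnDiscriminantBy_mul (actsOnDiscriminantBy_neg_of_gramReflection hgw)
      (actsOnDiscriminantBy_neg_of_gramReflection hhw)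
    rwa [neg_mul_neg] at h1
  rcases hε₁ with rfl | rfl <;> rcases hε₂ with rfl | rfl
  · exact Or.inl ⟨by rw [hdet]; norm_num, by simpa using hact⟩
  · exact Or.inr ⟨by rw [hdet]; norm_num, by simpa using hact⟩
  · exact Or.inr ⟨by rw [hdet]; norm_num, by simpa using hact⟩
  · exact Or.inl ⟨by rw [hdet]; norm_num, by simpa using hact⟩

end Det

/-! ### §5 The lattices of record: `Λ_n = k3HilbertGram n` (rank `23`) and `kumGram n` (rank `7`) -/

/-- `rk Λ_n = 23` is odd. [cite: Markman2024, §1.3 Step 1] -/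
theorem odd_card_k3HilbertIndex : Odd (Fintype.card K3HilbertIndex) := by
  rw [card_k3HilbertIndex]; exact ⟨11, by norm_num⟩

/-- `rk H²(Kumⁿ, ℤ) = 7` is odd. [cite: Markman2023GeneralizedKummers, §1.1 p. 234] -/
theorem odd_card_kumIndex : Odd (Fintype.card KumIndex) := by
  rw [card_kumIndex]; exact ⟨3, by norm_num⟩

/-- **`K3^{[n]}`-type: `det ρ_u = (u,u)/2`** for every generator of `𝒲(Λ_n)`, `Λ_n = Λ_{K3} ⊕ ⟨2−2n⟩`.
[cite: Markman2023GeneralizedKummers, §1.1 p. 234] [cite: Markman2011Survey, §9.1.1] -/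
theorem det_gramReflection_k3HilbertGram (n : ℕ) {g : (K3HilbertIndex → ℤ) ≃ₗ[ℤ] (K3HilbertIndex → ℤ)}
    {u : K3HilbertIndex → ℤ} {ε : ℤ} (hε : ε = 1 ∨ ε = -1) (hu : gramPairing (k3HilbertGram n) u u = 2 * ε)
    (hg : ∀ w, g w = -ε • w + gramPairing (k3HilbertGram n) w u • u) : LinearMap.det g.toLinearMap = ε :=
  det_gramReflection_of_odd odd_card_k3HilbertIndex hε hu hg

/-- **`K3^{[n]}`-type: every `g ∈ 𝒲(Λ_n)` is an isometry of `Λ_n` acting on `Λ_n^*/Λ_n` by `±1`.**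
[cite: Markman2023GeneralizedKummers, §1.1 (1.3)–(1.4), p. 234] [cite: Markman2011Survey, §9.1.1, Lemma 9.2] -/
theorem isometry_and_actsOnDiscriminantBy_of_mem_reflectionGroup_k3HilbertGram (n : ℕ)
    {g : (K3HilbertIndex → ℤ) ≃ₗ[ℤ] (K3HilbertIndex → ℤ)} (hg : g ∈ reflectionGroup (k3HilbertGram n)) :
    (∀ w w', gramPairing (k3HilbertGram n) (g w) (g w') = gramPairing (k3HilbertGram n) w w') ∧
      (ActsOnDiscriminantBy (k3HilbertGram n) g 1 ∨ ActsOnDiscriminantBy (k3HilbertGram n) g (-1)) :=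
  isometry_and_actsOnDiscriminantBy_of_mem_reflectionGroup (k3HilbertGram_transpose n) hg

/-- **`Kumⁿ`-type: `det ρ_u = (u,u)/2`** for every generator of `𝒲(H²(Y,ℤ))`, `H²(Y,ℤ) ≅ kumGram n`.
[cite: Markman2023GeneralizedKummers, §1.1 p. 234 ("Note that `det(r_u) = (u,u)/2`")] -/
theorem det_gramReflection_kumGram (n : ℕ) {g : (KumIndex → ℤ) ≃ₗ[ℤ] (KumIndex → ℤ)} {u : KumIndex → ℤ} {ε : ℤ}
    (hε : ε = 1 ∨ ε = -1) (hu : gramPairing (kumGram n) u u = 2 * ε)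
    (hg : ∀ w, g w = -ε • w + gramPairing (kumGram n) w u • u) : LinearMap.det g.toLinearMap = ε :=
  det_gramReflection_of_odd odd_card_kumIndex hε hu hg

/-- **`Kumⁿ`-type: every `g ∈ 𝒲` is an isometry acting on `H²(Y,ℤ)^*/H²(Y,ℤ)` by `±1`** ("has order `2` and is generated by
multiplication by `−1`"). [cite: Markman2023GeneralizedKummers, §1.1 (1.3)–(1.4), p. 234] [cite: OGrady2021KummerTori, Cor. 1.4] -/
theorem isometry_and_actsOnDiscriminantBy_of_mem_reflectionGroup_kumGram (n : ℕ)
    {g : (KumIndex → ℤ) ≃ₗ[ℤ] (KumIndex → ℤ)} (hg : g ∈ reflectionGroup (kumGram n)) :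
    (∀ w w', gramPairing (kumGram n) (g w) (g w') = gramPairing (kumGram n) w w') ∧
      (ActsOnDiscriminantBy (kumGram n) g 1 ∨ ActsOnDiscriminantBy (kumGram n) g (-1)) :=
  isometry_and_actsOnDiscriminantBy_of_mem_reflectionGroup (kumGram_transpose n) hg

/-- **`Kumⁿ`-type: `ρ_u ρ_v ∈ 𝒲^{det·χ} = Mon²`-candidates** — non-trivial elements of the tree's `detChiKer (kumGram n)`.
[cite: Markman2023GeneralizedKummers, §1.1 p. 234 and Thm. 1.2] -/
theorem mul_mem_detChiKer_kumGram (n : ℕ) {g h : (KumIndex → ℤ) ≃ₗ[ℤ] (KumIndex → ℤ)}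
    (hg : g ∈ gramReflections (kumGram n)) (hh : h ∈ gramReflections (kumGram n)) : g * h ∈ detChiKer (kumGram n) :=
  mul_mem_detChiKer_of_gramReflections odd_card_kumIndex hg hh

end Literature.AlgebraicGeometry.Hyperkaehler
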